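import Mathlib
import Literature.Probability.Percolation.PercolationProofs
import Literature.Probability.LatticeModels.ProdBernoulliIndependence
import Literature.Probability.Percolation.KozmaNitzanPinning
import Summits.CriticalPhenomena.PercolationContinuityZ3.Theorems.PercNearOneGluingNoHeavyLowerTailFatMinorityPieceGluing
import Summits.CriticalPhenomena.PercolationContinuityZ3.Theorems.PercNearOneGluingNoHeavyLowerTailFatMinorityOrderedAnchor
import HarnessLib

/-!
# `NoHeavyLowerTail` (stmt-CriticalPhenomena-4575), line fat-minority-linear — the ordered-anchor theorem
# under the UNGLUED ordering hypothesis `OL`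

Route task `nh-dp-fatminority` (gen 5).  Setting of `orderedAnchor_of_pieces` (glued block `o`–`X`, relays
`A ∋ a, b`, injective rank).  `orderedAnchor_pre`: if for every relay `c ∉ {a,b}` the anchor is at most as
reliable as `c` in `Γ'_c = pinW w (T_c ∪ star) ∅` (the block's pairs to `o` AND the attachments into
earlier relays deleted — the ordering hypothesis `OL(a)` of `FINDINGS-fat-minority-gen5.md` §4), then
`μ(o ↔ A, o ↮ b) ≤ μ(o ↔ A, a ↮ b)`.  Proof: the piece lemma `pieceGluing_obs` (signed Lemma 3(i) at the
block) turns `OL` into the piece inequalities of `orderedAnchor_of_pieces`.  `OL` implies the glued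
criterion of `orderedAnchor_glued` but not conversely (§7–8).  No new definitions.
-/

namespace Summit.CriticalPhenomena.PercolationContinuityZ3.Theorems

open MeasureTheory Set
open Literature.Probability.LatticeModels (prodBernoulli)
open Literature.Probability.Percolation (BondConfig openConn openGraph openGraph_adj)
open scoped BigOperators

noncomputable section
open Classical
open Literature.Probability.LatticeModels Literature.Probability.Percolation

variable {n : ℕ}

/-- **Ordered-anchor theorem for a glued block under the unglued ordering hypothesis (pre-FKG form).**
`o ∉ A ∪ X`, `X ∩ A = ∅`, `b, a ∈ A`; `o`'s pairs to `X` have weight `1` and `o` has no other positive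
pair; units are attached only to `A ∪ {o}`; `rk` injective on `A`.  If for every `c ∈ A ∖ {a, b}`,
`μ_{Γ'_c}(a ↔ b) ≤ μ_{Γ'_c}(c ↔ b)` with `Γ'_c = pinW w (T_c ∪ star) ∅`,
`T_c = {s(x,c') : x ∈ X, c' ∈ A, rk c' < rk c}`, then `μ(o ↔ A, o ↮ b) ≤ μ(o ↔ A, a ↮ b)`.
[cite: KozmaNitzan2024, §3.2 Theorems 4–5 and Question 9 (p. 36); VandenbergHaggstromKahn2005, Thm. 1.3–1.4] -/
theorem orderedAnchor_pre (w : Sym2 (Fin n) → unitInterval) (X A : Finset (Fin n)) (o a b : Fin n)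
    (rk : Fin n → ℕ) (hrk : Set.InjOn rk ↑A)
    (hoX : o ∉ X) (hoA : o ∉ A) (hXA : Disjoint X A) (hb : b ∈ A) (ha : a ∈ A)
    (hstar : ∀ x ∈ X, w s(o, x) = 1)
    (hstar0 : ∀ y : Fin n, y ≠ o → y ∉ X → w s(o, y) = 0)
    (hunit : ∀ x ∈ X, ∀ z : Fin n, z ≠ o → z ∉ A → w s(x, z) = 0)
    (hOL : ∀ c ∈ A, c ≠ a → c ≠ b →
      (prodBernoulli (pinW w
          ((↑((X ×ˢ A.filter fun d => rk d < rk c).image fun p => s(p.1, p.2)) : Set (Sym2 (Fin n))) ∪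
            ↑(X.image fun x => s(o, x))) ∅)).real (openConn a b) ≤
      (prodBernoulli (pinW w
          ((↑((X ×ˢ A.filter fun d => rk d < rk c).image fun p => s(p.1, p.2)) : Set (Sym2 (Fin n))) ∪
            ↑(X.image fun x => s(o, x))) ∅)).real (openConn c b)) :
    (prodBernoulli w).real ((⋃ c ∈ A, openConn o c) ∩ (openConn o b)ᶜ) ≤
      (prodBernoulli w).real ((⋃ c ∈ A, openConn o c) ∩ (openConn a b)ᶜ) := by
  refine orderedAnchor_of_pieces w X A o a b rk hrk hoX hoA hXA hb ha hstar hstar0 hunit ?_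
  intro c hc hca hcb
  have hcX : c ∉ X := fun h => Finset.disjoint_left.1 hXA h hc
  set T : Finset (Sym2 (Fin n)) := (X ×ˢ A.filter fun d => rk d < rk c).image fun p => s(p.1, p.2) with hT
  set wc := pinW w (↑T : Set (Sym2 (Fin n))) ∅ with hwc
  -- the pinned weighting is still a sure star at `o`
  have hstar' : ∀ x ∈ X, wc s(o, x) = 1 := by
    intro x hx
    have hnot : s(o, x) ∉ (↑T : Set (Sym2 (Fin n))) := by
      intro h
      obtain ⟨p, hp, hpe⟩ := Finset.mem_image.1 (Finset.mem_coe.1 h)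
      obtain ⟨hp1, hp2⟩ := Finset.mem_product.1 hp
      have hp2A : p.2 ∈ A := (Finset.mem_filter.1 hp2).1
      rcases Sym2.eq_iff.1 hpe with ⟨h1, _⟩ | ⟨_, h2⟩
      · exact hoX (h1 ▸ hp1)
      · exact hoA (h2 ▸ hp2A)
    rw [hwc, pinW_apply_of_not_mem w ∅ hnot]
    exact hstar x hx
  have hle' : (prodBernoulli (pinW wc (↑(X.image fun x => s(o, x)) : Set (Sym2 (Fin n))) ∅)).real
        (openConn a b) ≤
      (prodBernoulli (pinW wc (↑(X.image fun x => s(o, x)) : Set (Sym2 (Fin n))) ∅)).real (openConn c b) := by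
    rw [hwc, pinW_pinW_same]
    exact hOL c hc hca hcb
  exact pieceGluing_obs wc X o a c b hoX hcX hstar' hle'

end

end Summit.CriticalPhenomena.PercolationContinuityZ3.Theorems
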